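import Summits.BirchSwinnertonDyer.Rank1Residual.X2.SelmerDivisibleOfNoFiniteSubmodule
import Summits.BirchSwinnertonDyer.Rank1Residual.X2.NonPrimitiveLambdaInvariantMultiplicativeDerived
import Summits.BirchSwinnertonDyer.Rank1Residual.X2.TateLineUnique
import Summits.BirchSwinnertonDyer.Rank1Residual.X2.GreenbergSelmerCountNonsplit
import Literature.NumberTheory.EllipticCurves.BSDSelmerParityDokchitserTowerProofs
import HarnessLib

/-!
# GV Prop. (2.5)/p. 25 at an odd MULTIPLICATIVE prime DERIVED: the record A135
# `GreenbergVatsal2000.datumSelmer_divisible_of_finite_torsionBy` (divisibility of the non-primitive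
# datum Selmer group `S^{Σ₀}_A(ℚ_∞)` at `μ = 0`) follows, at every odd `p ‖ N`, from Greenberg's
# Prop. 4.15 (ii) (LNM 1716), GV Cor. (2.3)'s divisible quotient (T-GV23L) and the trivial zero
# (A137′), granted the Tate uniformisations A40/A41

HONEST FRAMING (BSD rank-`≤ 1` residual cell `b2b-bsdres`, home
`run/shared/lean/b2b/bsd-rank1-residual/`, unit `b2b-bsdres-eisenstein-p2`, class X2 = odd
multiplicative Eisenstein primes; research route, no claim beyond stated classes; nothing booked
here; labels unchanged): the cell deletes the COMBINATION-SHAPED residual classes of the rank-`≤ 1`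
BSD formula from PUBLISHED theorems only and TYPES the construction-shaped ones; this is not
"finishing BSD". THEOREMS ONLY (no definition, no named fact, nothing asserted).

## What (gen 31, programme P2 step 2; registry: A135 DERIVED ⇐ {Prop. 4.15 (ii), T-GV23L, A137′, A40, A41})

A135 (GV §2 Prop. (2.5) p. 23 with p. 25, consequence form): for `E/ℚ`, `p` odd, `κ` cyclotomic,
Greenberg data `L` above `p` with `C` a divisible line (`#(C ∩ A[p]) = p`) and INERTIA-TRIVIAL
quotient `D = A/C`, a finite `Σ₀ ∌ p` containing the bad places: `S^{Σ₀}_A(ℚ_∞)[p]` finite ⟹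
`S^{Σ₀}_A(ℚ_∞) = p · S^{Σ₀}_A(ℚ_∞)`. GV prove it from [Gre89] Prop. 5 (no finite submodules in
`H¹(ℚ_Σ/ℚ_∞, A)^` when `H² = 0`), the `Λ`-cofreeness of `𝓗_p(ℚ_∞)` and Lemma (2.6). THIS FILE derives
the same conclusion at every odd prime of MULTIPLICATIVE reduction of a globally minimal `E/ℚ` — the
only primes at which class X2 uses it — by a different route, from records already in the registry:

1. the datum is UNIQUE (gen 27, `TateLineUnique.data_eq_of_inertia_of_multiplicative`, A41): any `L`
   as above IS the (twisted) Tate datum, for which the classical condition at `p` is the STRICT one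
   (Greenberg p. 76, gens 12–13: `exists_data_of_split` / `exists_data_of_not_split`,
   `selmerInfty_eq_gvStrictSelmerInfty_of_strictKer_eq`), so
   `Sel_{p^∞}(E/ℚ_∞) = S^{str}_A(ℚ_∞) ≤ S_A(ℚ_∞) ≤ S^{Σ₀}_A(ℚ_∞)`;
2. `Sel_{p^∞}(E/ℚ_∞)` is divisible: Greenberg's Prop. 4.15 (ii) (record
   `Greenberg1999.prop415ii_noFiniteSubmodule_of_ordinary_or_multiplicative`) + `μ = 0` + Pontryagin
   (`SelmerDivisibleOfNoFiniteSubmodule.selmerInfty_divisible_of_prop415ii_of_finite_torsionBy`);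
3. `S_A/S^{str}_A` is divisible: trivial at a non-split prime (`greenbergKer = strictKer`, no trivial
   zero); at a split prime it embeds in `D ≅ ℚ_p/ℤ_p` by the trivial-zero map
   (`TrivialZeroQuotient.exists_trivialZeroHom`; `#(S_A/S^{str})[p] ∣ p`), it is INFINITE (A137′,
   record `datumStrictSelmer_relIndex_eq_zero_of_split`, GV p. 15 with Prop. (2.1)'s proof p. 20),
   hence of `ℤ_p`-corank `1` (`TrivialZeroQuotientCorank.zpCorank_quotient_eq_one_of_infinite`), and
   `#Q[p] = p^{corank Q}·#(Q/pQ)` (`ZpCorank.pow_zpCorank_mul_natCard_modN`) forces `Q = pQ`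
   (`exists_nsmul_sub_mem_strict_of_infinite`);
4. `S^{Σ₀}_A/S_A` is divisible: the fifth conjunct of T-GV23L (record
   `datumSelmer_nonPrimitive_invariants`: GV Cor. (2.3), "`S^{Σ₀}_A/S_A ≅ ∏ 𝓗_ℓ(ℚ_∞)`", each
   `𝓗_ℓ(ℚ_∞)` divisible, p. 17), whose cotorsion hypothesis on `S_A` follows from the finiteness of
   `S^{Σ₀}_A[p]` (gen 27, `moduleFinite_and_isTorsion_datumDualData_of_finite_torsionBy`) and whose
   "`H⁰(ℚ_∞, A*)` finite" is gen 9's `finite_fixedPoints_kerSubgroup_of_hasMultiplicativeReductionAtPrime`;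
5. two applications of "divisible-by-divisible is divisible".

Main theorem **`datumSelmer_divisible_of_finite_torsionBy_multiplicative`**: A135's conclusion with
A135's binders (`W`, `p ≠ 2`, `κ` cyclotomic, `L`, `hC`, `hD`, `Σ₀ ∌ p`, `S^{Σ₀}_A[p]` finite),
restricted to `W` globally minimal with multiplicative reduction at `p`, and WITHOUT A135's
hypothesis "good reduction outside `Σ₀ ∪ {p}`" (not needed on this route), from the five records
`h415`, `h23`, `hInf`, `hT`, `hT'` — by cases from `…_of_split` (binders `h415`, `h23`, `hInf`,
`hT` = A40) and `…_of_not_split` (binders `h415`, `h23`, `hT'` = A41), both through the core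
`datumSelmer_divisible_of_strictKer_eq`. The X2a chain's use of A135
(`GreenbergSelmerCountLe.exists_data_count_le_of_{not_split,split}`, binder `hB`) is exactly this
shape; the term of record `ClassClosureDatumFree.targetA_datumFree` (13 binders, A135 among them)
is NOT re-threaded here (the alternative would bind 15 records); the registry consequence is that
A135 is DERIVED from records already load-bearing elsewhere in the cell.

References: R. Greenberg, V. Vatsal, Invent. Math. 142 (2000) = arXiv:math/9906215, §2 Prop.
(2.1) p. 17 and its proof p. 20, Cor. (2.3) pp. 20–21, Prop. (2.5) p. 23, p. 25, pp. 14–16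
(`p ‖ N`); R. Greenberg, LNM 1716 (1999), Prop. 4.15 (ii), §2 p. 76, §1 p. 60; J. Silverman,
ATAEC (1994) Ch. V Thm. 3.1, Lemma 5.2, Thm. 5.3, Cor. 5.4.
-/

noncomputable section

open scoped Classical AddSubgroup

namespace Summit.BirchSwinnertonDyer.Rank1Residual.X2.DatumSelmerDivisibleDerived

open NumberField IsDedekindDomain Field WeierstrassCurve
  Literature.NumberTheory.EllipticCurves Literature.NumberTheory.EllipticCurves.GreenbergSelmer
  Literature.NumberTheory.EllipticCurves.GreenbergVatsal2000
  Literature.NumberTheory.GaloisRepresentations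
  Summit.BirchSwinnertonDyer.Rank1Residual.X2.GreenbergVatsalTorsion
  Summit.BirchSwinnertonDyer.Rank1Residual.X2.GreenbergVatsalTateDatumCofree
  Summit.BirchSwinnertonDyer.Rank1Residual.X2.GreenbergVatsalTransferMultiplicative
  Summit.BirchSwinnertonDyer.Rank1Residual.X2.GreenbergVatsalStrictSelmer
  Summit.BirchSwinnertonDyer.Rank1Residual.X2.GreenbergSelmerCountNonsplit
  Summit.BirchSwinnertonDyer.Rank1Residual.X2.TrivialZeroQuotient
  Summit.BirchSwinnertonDyer.Rank1Residual.X2.TrivialZeroQuotientCorank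
  Summit.BirchSwinnertonDyer.Rank1Residual.X2.TrivialZeroCorankAlgebra
  Summit.BirchSwinnertonDyer.Rank1Residual.X2.TrivialZeroStrictInclusionDerived
  Summit.BirchSwinnertonDyer.Rank1Residual.X2.TateLineUnique
  Summit.BirchSwinnertonDyer.Rank1Residual.X2.NonPrimitiveLambdaInvariantSplitOfDatum
  Summit.BirchSwinnertonDyer.Rank1Residual.X2.SelmerDivisibleOfNoFiniteSubmodule

variable (W : WeierstrassCurve ℚ) [W.IsElliptic] (p : ℕ) [hp : Fact p.Prime] (κ : ZpExtension ℚ p)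

/-! ## §1. The trivial-zero quotient at a split prime is divisible when infinite -/

/-- **An infinite trivial-zero quotient is `p`-divisible.** For Greenberg data `L` above `p` with
`C` a divisible line (`#(C ∩ A[p]) = p`) and `D_v`-trivial quotient `D` (the Tate datum at a split
prime), `κ` cyclotomic: if `Q = S_A(ℚ_∞)/S^{str}_A(ℚ_∞)` is infinite then every `s ∈ S_A(ℚ_∞)` is
`p·t` modulo `S^{str}_A(ℚ_∞)` with `t ∈ S_A(ℚ_∞)`. (`Q ↪ D` by the trivial-zero map, so
`#Q[p] ∣ #D[p] = p`; `Q` infinite of corank `≤ 1` has corank `1`; `#Q[p] = p^{corank}·#(Q/pQ)` gives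
`Q/pQ = 0`.) GV p. 15: at a split prime `S_A(ℚ_∞)` "is actually bigger" than the Selmer group, the
excess being `H¹_{unr}((ℚ_∞)_η, D) ≅ ℚ_p/ℤ_p`. [cite: GreenbergVatsal2000, §2 pp. 14–16, 20] -/
theorem exists_nsmul_sub_mem_strict_of_infinite (hκ : κ.IsCyclotomic)
    (L : Data ℚ (W.geomPrimaryTorsion p) p)
    (hC : ∀ (v : HeightOneSpectrum (𝓞 ℚ)) (hv : ((p : ℕ) : 𝓞 ℚ) ∈ v.asIdeal),
      (∀ c ∈ (L v hv).plus, ∃ c' ∈ (L v hv).plus, p • c' = c) ∧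
        Nat.card ↥((L v hv).plus ⊓ (↥(W.geomPrimaryTorsion p))[(p : ℤ)]) = p)
    (htrivD : ∀ (v : HeightOneSpectrum (𝓞 ℚ)) (hv : ((p : ℕ) : 𝓞 ℚ) ∈ v.asIdeal),
      ∀ (δ : decomp (K := ℚ) v) (d : (L v hv).Gr), δ • d = d)
    [hinf : Infinite (↥(gvSelmerInfty κ (W.geomPrimaryTorsion p) L ∅) ⧸
      (gvStrictSelmerInfty κ (W.geomPrimaryTorsion p) L ∅).addSubgroupOf
        (gvSelmerInfty κ (W.geomPrimaryTorsion p) L ∅))] :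
    ∀ s ∈ gvSelmerInfty κ (W.geomPrimaryTorsion p) L ∅,
      ∃ t ∈ gvSelmerInfty κ (W.geomPrimaryTorsion p) L ∅,
        p • t - s ∈ gvStrictSelmerInfty κ (W.geomPrimaryTorsion p) L ∅ := by
  set S := gvSelmerInfty κ (W.geomPrimaryTorsion p) L ∅ with hSdef
  set N := (gvStrictSelmerInfty κ (W.geomPrimaryTorsion p) L ∅).addSubgroupOf S with hNdef
  -- `Q = S/N` is `p`-primary with finite `p`-torsion of order dividing `p`, and of corank `1`
  have hprim : ∀ q : ↥S ⧸ N, ∃ n : ℕ, p ^ n • q = 0 :=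
    DualRestrictionSelmer.isPrimary_quotient W κ L ∅
      (T := gvStrictSelmerInfty κ (W.geomPrimaryTorsion p) L ∅)
  obtain ⟨hfinQ, -⟩ := finite_torsionBy_quotient_and_zpCorank_le W p κ L ∅ hκ hC htrivD
  haveI := hfinQ
  have hcork : zpCorank (↥S ⧸ N) p = 1 :=
    zpCorank_quotient_eq_one_of_infinite W p κ L ∅ hκ hC htrivD
  -- `#Q[p] ∣ p` through the trivial-zero map `Φ : S → D`
  set v₀ : HeightOneSpectrum (𝓞 ℚ) := (Rat.HeightOneSpectrum.primesEquiv (R := 𝓞 ℚ)).symm ⟨p, hp.out⟩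
    with hv₀def
  have hv₀ : ((p : ℕ) : 𝓞 ℚ) ∈ v₀.asIdeal :=
    (natCast_mem_asIdeal_iff_eq_primesEquiv_symm v₀ hp.out).mpr hv₀def
  obtain ⟨Φ, hΦ⟩ := exists_trivialZeroHom W p κ L htrivD ∅ hκ hv₀
  have hN : N = Φ.ker := by
    ext c
    rw [hNdef, AddSubgroup.mem_addSubgroupOf, AddMonoidHom.mem_ker, hΦ]
  let e : ↥S ⧸ N ≃+ Φ.range :=
    (QuotientAddGroup.quotientAddEquivOfEq hN).trans (QuotientAddGroup.quotientKerEquivRange Φ)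
  obtain ⟨hfinGr, hcardGr⟩ :=
    finite_and_natCard_torsionBy_gr W p (L v₀ hv₀) (hC v₀ hv₀).1 (hC v₀ hv₀).2
  haveI := hfinGr
  obtain ⟨hfinR, hdvd⟩ := finite_and_natCard_torsionBy_dvd_of_le (p : ℤ) Φ.range
  rw [hcardGr] at hdvd
  have hcardQ : Nat.card ((↥S ⧸ N)[(p : ℤ)]) ∣ p := by
    rw [Nat.card_congr (torsionByEquiv e p).toEquiv]; exact hdvd
  -- `#Q[p] = p · #(Q/pQ)` forces `#(Q/pQ) = 1`
  have hformula := pow_zpCorank_mul_natCard_modN (p := p) hprim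
  rw [hcork, pow_one] at hformula
  have hQp_pos : 0 < Nat.card ((↥S ⧸ N)[(p : ℤ)]) := Nat.card_pos
  have hle : p * Nat.card (ModN (↥S ⧸ N) p) ≤ p := by
    rw [hformula]; exact Nat.le_of_dvd hp.out.pos hcardQ
  have hmod_pos : 0 < Nat.card (ModN (↥S ⧸ N) p) := by
    rcases Nat.eq_zero_or_pos (Nat.card (ModN (↥S ⧸ N) p)) with h0 | h0
    · rw [h0, mul_zero] at hformula; omega
    · exact h0
  have hmod_one : Nat.card (ModN (↥S ⧸ N) p) = 1 := by
    have h1 : Nat.card (ModN (↥S ⧸ N) p) ≤ 1 := by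
      by_contra h; push Not at h
      have : p * 2 ≤ p * Nat.card (ModN (↥S ⧸ N) p) := Nat.mul_le_mul_left p h
      omega
    omega
  haveI hsub : Subsingleton (ModN (↥S ⧸ N) p) := (Nat.card_eq_one_iff_unique.mp hmod_one).1
  -- read off divisibility of `Q`
  intro s hs
  have hq0 : ModN.mkQ p (QuotientAddGroup.mk (s := N) ⟨s, hs⟩) = 0 := Subsingleton.elim _ _
  obtain ⟨q', hq'⟩ : (QuotientAddGroup.mk (s := N) ⟨s, hs⟩ : ↥S ⧸ N) ∈
      LinearMap.range (LinearMap.lsmul ℤ (↥S ⧸ N) p) := (Submodule.Quotient.mk_eq_zero _).mp hq0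
  obtain ⟨t, rfl⟩ := QuotientAddGroup.mk_surjective q'
  refine ⟨(t : W.subgroupH1 p κ.kerSubgroup), t.2, ?_⟩
  have hmk : (QuotientAddGroup.mk (s := N) (p • t - ⟨s, hs⟩) : ↥S ⧸ N) = 0 := by
    rw [QuotientAddGroup.mk_sub, QuotientAddGroup.mk_nsmul, sub_eq_zero, ← natCast_zsmul]
    exact hq'
  rw [QuotientAddGroup.eq_zero_iff, hNdef, AddSubgroup.mem_addSubgroupOf] at hmk
  simpa using hmk

/-! ## §2. The core: `Sel = S^{str}_A` divisible, `S_A/S^{str}_A` divisible, `S^{Σ₀}_A/S_A` divisible -/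

variable [W.IsGloballyMinimal]

/-- **Core assembly.** For `E/ℚ` globally minimal, `p ≥ 3` (`p ≠ 2`) of multiplicative reduction,
`κ` cyclotomic with topological generator `γ`, Greenberg data `L` above `p` with `C` a divisible
line, the STRICT condition at `p` equal to the Kummer condition (`hRD`, Greenberg p. 76 for the Tate
datum), `S_A/S^{str}_A` divisible (`hQA`), `E(ℚ_∞)[p^∞]` finite (`hA`) and `Σ₀ ∌ p` finite: if
`S^{Σ₀}_A(ℚ_∞)[p]` is finite then `S^{Σ₀}_A(ℚ_∞) = p · S^{Σ₀}_A(ℚ_∞)`, granted Prop. 4.15 (ii) (`h415`: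
`Sel_{p^∞}(E/ℚ_∞) = S^{str}_A(ℚ_∞)` is divisible) and Cor. (2.3) (`h23`: `S^{Σ₀}_A/S_A` divisible).
[cite: GreenbergVatsal2000, §2 Prop. (2.5) p. 23, p. 25; Cor. (2.3) pp. 20–21]
[cite: GreenbergLNM1716, Prop. 4.15 (ii); §2 p. 76] -/
theorem datumSelmer_divisible_of_strictKer_eq
    (h415 : Greenberg1999.prop415ii_noFiniteSubmodule_of_ordinary_or_multiplicative)
    (h23 : datumSelmer_nonPrimitive_invariants)
    (hp2 : p ≠ 2) (hmult : W.HasMultiplicativeReductionAtPrime p) (hκ : κ.IsCyclotomic)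
    {γ : absoluteGaloisGroup ℚ} (hγ : κ.IsTopGenerator γ)
    (L : Data ℚ (W.geomPrimaryTorsion p) p)
    (hC : ∀ (v : HeightOneSpectrum (𝓞 ℚ)) (hv : ((p : ℕ) : 𝓞 ℚ) ∈ v.asIdeal),
      (∀ c ∈ (L v hv).plus, ∃ c' ∈ (L v hv).plus, p • c' = c) ∧
        Nat.card ↥((L v hv).plus ⊓ (↥(W.geomPrimaryTorsion p))[(p : ℤ)]) = p)
    (hRD : ∀ (v : HeightOneSpectrum (𝓞 ℚ)) (hv : ((p : ℕ) : 𝓞 ℚ) ∈ v.asIdeal),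
      (L v hv).strictKer κ.kerSubgroup = W.localKerOver p κ.kerSubgroup (v.adicCompletion ℚ))
    (hQA : ∀ s ∈ gvSelmerInfty κ (W.geomPrimaryTorsion p) L ∅,
      ∃ t ∈ gvSelmerInfty κ (W.geomPrimaryTorsion p) L ∅,
        p • t - s ∈ gvStrictSelmerInfty κ (W.geomPrimaryTorsion p) L ∅)
    (hA : Finite (FixedPoints.addSubgroup κ.kerSubgroup (W.geomPrimaryTorsion p)))
    (S₀ : Finset (HeightOneSpectrum (𝓞 ℚ))) (hS₀ : ∀ v ∈ S₀, ((p : ℕ) : 𝓞 ℚ) ∉ v.asIdeal)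
    [hfin : Finite ↥(datumSelmerInfty κ (W.geomPrimaryTorsion p) L
        (↑S₀ : Set (HeightOneSpectrum (𝓞 ℚ))) ⊓
      (subgroupH1 κ.kerSubgroup (W.geomPrimaryTorsion p))[(p : ℤ)])] :
    ∀ s ∈ datumSelmerInfty κ (W.geomPrimaryTorsion p) L (↑S₀ : Set (HeightOneSpectrum (𝓞 ℚ))),
      ∃ t ∈ datumSelmerInfty κ (W.geomPrimaryTorsion p) L (↑S₀ : Set (HeightOneSpectrum (𝓞 ℚ))),
        p • t = s := by
  have hp3 : 3 ≤ p := by have := hp.out.two_le; omega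
  set A := W.geomPrimaryTorsion p with hAdef
  set S₀' : Set (HeightOneSpectrum (𝓞 ℚ)) := ↑S₀ with hS₀'
  -- `S_A ≤ S^{Σ₀}_A`, and the finiteness of the `p`-torsions of `S_A` and of `Sel`
  have hmono : datumSelmerInfty κ A L ∅ ≤ datumSelmerInfty κ A L S₀' :=
    GreenbergSelmerCountSplit.gvSelmerInfty_empty_le W p κ L S₀'
  haveI hfin0 : Finite ↥(datumSelmerInfty κ A L ∅ ⊓ (subgroupH1 κ.kerSubgroup A)[(p : ℤ)]) :=
    Finite.of_injective _ (AddSubgroup.inclusion_injective (inf_le_inf_right _ hmono))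
  -- `Sel_{p^∞}(E/ℚ_∞) = S^{str}_A(ℚ_∞)` is divisible (Prop. 4.15 (ii))
  have hSel : W.selmerInfty κ = gvStrictSelmerInfty κ A L ∅ :=
    selmerInfty_eq_gvStrictSelmerInfty_of_strictKer_eq W p κ hp2 hκ L hRD
  have hstr_le : gvStrictSelmerInfty κ A L ∅ ≤ gvSelmerInfty κ A L ∅ :=
    gvStrictSelmerInfty_le_gvSelmerInfty κ A L ∅
  haveI hfin0' : Finite ↥(gvSelmerInfty κ A L ∅ ⊓ (W.subgroupH1 p κ.kerSubgroup)[(p : ℤ)]) := hfin0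
  haveI : Finite ((↥(W.selmerInfty κ))[(p : ℤ)]) := by
    rw [hSel, ← finite_inf_torsionBy_iff]
    exact Finite.of_injective _ (AddSubgroup.inclusion_injective (inf_le_inf_right _ hstr_le))
  have hSelDiv : ∀ s ∈ gvStrictSelmerInfty κ A L ∅, ∃ t ∈ gvStrictSelmerInfty κ A L ∅, p • t = s := by
    rw [← hSel]
    exact selmerInfty_divisible_of_prop415ii_of_finite_torsionBy W p h415 hp3 (Or.inr hmult) hκ hγ
  -- `S_A` is divisible
  have hSA : ∀ s ∈ datumSelmerInfty κ A L ∅, ∃ t ∈ datumSelmerInfty κ A L ∅, p • t = s :=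
    divisible_of_divisible_quotient p hstr_le hSelDiv hQA
  -- `S^{Σ₀}_A/S_A` is divisible (Cor. (2.3), T-GV23L at the canonical duals)
  obtain ⟨hfg, hXt⟩ :=
    moduleFinite_and_isTorsion_datumDualData_of_finite_torsionBy W κ hγ L
      (∅ : Set (HeightOneSpectrum (𝓞 ℚ)))
  haveI := hfg
  obtain ⟨-, -, -, -, hQ⟩ :=
    h23 W p hp2 κ hκ γ hγ L hC hA S₀ hS₀ (datumDualData W κ L ∅ hγ) (datumDualData W κ L S₀' hγ) hXt
  exact divisible_of_divisible_quotient p hmono hSA hQ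

/-! ## §3. A135 at an odd multiplicative prime, derived -/

/-- **SPLIT odd `p ‖ N`: A135 ⇐ {Prop. 4.15 (ii), T-GV23L, A137′, A40}.** For `E/ℚ` globally
minimal with split multiplicative reduction at the odd prime `p`, `κ` cyclotomic, ANY Greenberg data
`L` above `p` with `C` a divisible line (`#(C ∩ A[p]) = p`) and inertia-trivial quotient, `Σ₀ ∌ p`
finite: `S^{Σ₀}_A(ℚ_∞)[p]` finite ⟹ `S^{Σ₀}_A(ℚ_∞) = p · S^{Σ₀}_A(ℚ_∞)`. The datum IS the Tate datum
(`localDatum_eq_of_inertia_of_split`, A40), whose trivial-zero quotient `S_A/S^{str}_A ↪ ℚ_p/ℤ_p` is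
infinite (A137′ `hInf`) hence divisible (§1); then §2.
[cite: GreenbergVatsal2000, §2 Prop. (2.5) p. 23, p. 25; Cor. (2.3) pp. 20–21; p. 15; Prop. (2.1) proof p. 20]
[cite: GreenbergLNM1716, Prop. 4.15 (ii); §2 p. 76] [cite: SilvermanATAEC1994, Ch. V Thm. 3.1] -/
theorem datumSelmer_divisible_of_finite_torsionBy_of_split
    (h415 : Greenberg1999.prop415ii_noFiniteSubmodule_of_ordinary_or_multiplicative)
    (h23 : datumSelmer_nonPrimitive_invariants)
    (hInf : datumStrictSelmer_relIndex_eq_zero_of_split)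
    (hT : Silverman1994_thmV53_tateUniformisation.{0})
    (hp2 : p ≠ 2) (hsplit : W.HasSplitMultiplicativeReductionAtPrime p) (hκ : κ.IsCyclotomic)
    (L : Data ℚ (W.geomPrimaryTorsion p) p)
    (hC : ∀ (v : HeightOneSpectrum (𝓞 ℚ)) (hv : ((p : ℕ) : 𝓞 ℚ) ∈ v.asIdeal),
      (∀ c ∈ (L v hv).plus, ∃ c' ∈ (L v hv).plus, p • c' = c) ∧
        Nat.card ↥((L v hv).plus ⊓ (↥(W.geomPrimaryTorsion p))[(p : ℤ)]) = p)
    (hD : ∀ (v : HeightOneSpectrum (𝓞 ℚ)) (hv : ((p : ℕ) : 𝓞 ℚ) ∈ v.asIdeal),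
      ∀ x ∈ inertia v, ∀ m : W.geomPrimaryTorsion p, x • m - m ∈ (L v hv).plus)
    (S₀ : Finset (HeightOneSpectrum (𝓞 ℚ))) (hS₀ : ∀ v ∈ S₀, ((p : ℕ) : 𝓞 ℚ) ∉ v.asIdeal)
    [hfin : Finite ↥(datumSelmerInfty κ (W.geomPrimaryTorsion p) L
        (↑S₀ : Set (HeightOneSpectrum (𝓞 ℚ))) ⊓
      (subgroupH1 κ.kerSubgroup (W.geomPrimaryTorsion p))[(p : ℤ)])] :
    ∀ s ∈ datumSelmerInfty κ (W.geomPrimaryTorsion p) L (↑S₀ : Set (HeightOneSpectrum (𝓞 ℚ))),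
      ∃ t ∈ datumSelmerInfty κ (W.geomPrimaryTorsion p) L (↑S₀ : Set (HeightOneSpectrum (𝓞 ℚ))),
        p • t = s := by
  obtain ⟨γ, hγ⟩ := κ.exists_isTopGenerator
  set A := W.geomPrimaryTorsion p with hAdef
  -- the datum is the Tate datum (A40)
  obtain ⟨L', htriv', -, hC', htrivD', hls', hsl'⟩ := exists_data_of_split W p κ hT hp2 hsplit
  have hLL : L = L' := localDatum_eq_of_inertia_of_split W p hT hp2 hsplit L L' hD
    (fun v hv ↦ (hC v hv).2) htriv' (fun v hv ↦ (hC' v hv).2)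
  subst hLL
  have hA : Finite (FixedPoints.addSubgroup κ.kerSubgroup A) :=
    GreenbergSelmerCountSplit.finite_fixedPoints_kerSubgroup_of_split W p κ hT hp2 hsplit hκ
  -- finiteness of `S_A[p]` and cotorsion of the canonical dual of `S_A`
  have hmono : datumSelmerInfty κ A L ∅ ≤ datumSelmerInfty κ A L (↑S₀ : Set (HeightOneSpectrum (𝓞 ℚ))) :=
    GreenbergSelmerCountSplit.gvSelmerInfty_empty_le W p κ L _
  haveI hfin0 : Finite ↥(datumSelmerInfty κ A L ∅ ⊓ (subgroupH1 κ.kerSubgroup A)[(p : ℤ)]) :=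
    Finite.of_injective _ (AddSubgroup.inclusion_injective (inf_le_inf_right _ hmono))
  obtain ⟨hfg, hXt⟩ :=
    moduleFinite_and_isTorsion_datumDualData_of_finite_torsionBy W κ hγ L
      (∅ : Set (HeightOneSpectrum (𝓞 ℚ)))
  haveI := hfg
  -- the trivial zero: `S_A/S^{str}_A` is infinite (A137′), hence divisible (§1)
  haveI : Infinite (↥(gvSelmerInfty κ A L ∅) ⧸
      (gvStrictSelmerInfty κ A L ∅).addSubgroupOf (gvSelmerInfty κ A L ∅)) := by
    rw [gvSelmerInfty_eq_datumSelmerInfty, gvStrictSelmerInfty_eq_datumStrictSelmerInfty]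
    exact hInf.infinite_quotient hp2 hsplit hκ hγ hC htrivD' (datumDualData W κ L ∅ hγ) hXt hA
  exact datumSelmer_divisible_of_strictKer_eq W p κ h415 h23 hp2 hsplit.hasMultiplicativeReductionAtPrime
    hκ hγ L hC (strictKer_eq_of_le_of_le W p κ L hls' hsl')
    (exists_nsmul_sub_mem_strict_of_infinite W p κ hκ L hC htrivD') hA S₀ hS₀

/-- **NON-SPLIT odd `p ‖ N`: A135 ⇐ {Prop. 4.15 (ii), T-GV23L, A41}** — no trivial zero: the datum
IS the twisted Tate datum (`data_eq_of_inertia_of_multiplicative`, A41), for which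
`greenbergKer = strictKer` (`S_A = S^{str}_A = Sel`); then §2.
[cite: GreenbergVatsal2000, §2 Prop. (2.5) p. 23, p. 25; Cor. (2.3) pp. 20–21; pp. 14–15]
[cite: GreenbergLNM1716, Prop. 4.15 (ii); §2 p. 76] [cite: SilvermanATAEC1994, Ch. V Thm. 5.3, Cor. 5.4] -/
theorem datumSelmer_divisible_of_finite_torsionBy_of_not_split
    (h415 : Greenberg1999.prop415ii_noFiniteSubmodule_of_ordinary_or_multiplicative)
    (h23 : datumSelmer_nonPrimitive_invariants)
    (hT' : Silverman1994_thmV53_corV54_tateUniformisation.{0})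
    (hp2 : p ≠ 2) (hmult : W.HasMultiplicativeReductionAtPrime p)
    (hns : ¬ W.HasSplitMultiplicativeReductionAtPrime p) (hκ : κ.IsCyclotomic)
    (L : Data ℚ (W.geomPrimaryTorsion p) p)
    (hC : ∀ (v : HeightOneSpectrum (𝓞 ℚ)) (hv : ((p : ℕ) : 𝓞 ℚ) ∈ v.asIdeal),
      (∀ c ∈ (L v hv).plus, ∃ c' ∈ (L v hv).plus, p • c' = c) ∧
        Nat.card ↥((L v hv).plus ⊓ (↥(W.geomPrimaryTorsion p))[(p : ℤ)]) = p)
    (hD : ∀ (v : HeightOneSpectrum (𝓞 ℚ)) (hv : ((p : ℕ) : 𝓞 ℚ) ∈ v.asIdeal),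
      ∀ x ∈ inertia v, ∀ m : W.geomPrimaryTorsion p, x • m - m ∈ (L v hv).plus)
    (S₀ : Finset (HeightOneSpectrum (𝓞 ℚ))) (hS₀ : ∀ v ∈ S₀, ((p : ℕ) : 𝓞 ℚ) ∉ v.asIdeal)
    [hfin : Finite ↥(datumSelmerInfty κ (W.geomPrimaryTorsion p) L
        (↑S₀ : Set (HeightOneSpectrum (𝓞 ℚ))) ⊓
      (subgroupH1 κ.kerSubgroup (W.geomPrimaryTorsion p))[(p : ℤ)])] :
    ∀ s ∈ datumSelmerInfty κ (W.geomPrimaryTorsion p) L (↑S₀ : Set (HeightOneSpectrum (𝓞 ℚ))),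
      ∃ t ∈ datumSelmerInfty κ (W.geomPrimaryTorsion p) L (↑S₀ : Set (HeightOneSpectrum (𝓞 ℚ))),
        p • t = s := by
  obtain ⟨γ, hγ⟩ := κ.exists_isTopGenerator
  set A := W.geomPrimaryTorsion p with hAdef
  -- the datum is the twisted Tate datum (A41)
  obtain ⟨L', htriv', -, hC', hgs', hls', hsl'⟩ := exists_data_of_not_split W p κ hT' hκ hp2 hmult hns
  have hLL : L = L' := data_eq_of_inertia_of_multiplicative W p hT' hp2 hmult L L' hD
    (fun v hv ↦ (hC v hv).2) htriv' (fun v hv ↦ (hC' v hv).2)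
  subst hLL
  have hA : Finite (FixedPoints.addSubgroup κ.kerSubgroup A) :=
    finite_fixedPoints_kerSubgroup_of_hasMultiplicativeReductionAtPrime W p hT' hp2 hmult κ hκ
  -- no trivial zero: `S^{str}_A = S_A`
  have hQA : ∀ s ∈ gvSelmerInfty κ A L ∅, ∃ t ∈ gvSelmerInfty κ A L ∅,
      p • t - s ∈ gvStrictSelmerInfty κ A L ∅ := fun s hs ↦ ⟨0, zero_mem _, by
    rw [nsmul_zero, zero_sub, gvStrictSelmerInfty_eq_gvSelmerInfty_of_forall_eq κ A L ∅ hgs']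
    exact neg_mem hs⟩
  exact datumSelmer_divisible_of_strictKer_eq W p κ h415 h23 hp2 hmult hκ hγ L hC
    (strictKer_eq_of_le_of_le W p κ L hls' hsl') hQA hA S₀ hS₀

/-- **GV Prop. (2.5)/p. 25 at an odd `p ‖ N`, DERIVED (registry: A135 ⇐ {Prop. 4.15 (ii), T-GV23L,
A137′, A40, A41}).** For `E/ℚ` globally minimal with multiplicative reduction at the odd prime `p`,
`κ` the cyclotomic `ℤ_p`-extension, Greenberg data `L` above `p` whose `C` is a divisible line
(`#(C ∩ E[p^∞][p]) = p`) with inertia-trivial quotient, and a finite `Σ₀ ∌ p`: if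
`S^{Σ₀}_A(ℚ_∞)[p]` is finite then `S^{Σ₀}_A(ℚ_∞) = p · S^{Σ₀}_A(ℚ_∞)` — the conclusion of the record
`datumSelmer_divisible_of_finite_torsionBy` with its binders (its hypothesis "good reduction outside
`Σ₀ ∪ {p}`" is not needed here), by cases from the two preceding theorems. GV p. 25: "By Proposition
(2.5) its `𝒪`-torsion submodule is `0`, and so `S^{Σ₀}_A(ℚ_∞)` is `𝒪`-divisible."
[cite: GreenbergVatsal2000, §2 Prop. (2.5) p. 23, p. 25; Cor. (2.3) pp. 20–21; pp. 14–16; Prop. (2.1) proof p. 20]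
[cite: GreenbergLNM1716, Prop. 4.15 (ii); §2 p. 76]
[cite: SilvermanATAEC1994, Ch. V Thm. 3.1, Lemma 5.2, Thm. 5.3, Cor. 5.4] -/
theorem datumSelmer_divisible_of_finite_torsionBy_multiplicative
    (h415 : Greenberg1999.prop415ii_noFiniteSubmodule_of_ordinary_or_multiplicative)
    (h23 : datumSelmer_nonPrimitive_invariants)
    (hInf : datumStrictSelmer_relIndex_eq_zero_of_split)
    (hT : Silverman1994_thmV53_tateUniformisation.{0})
    (hT' : Silverman1994_thmV53_corV54_tateUniformisation.{0})
    (hp2 : p ≠ 2) (hmult : W.HasMultiplicativeReductionAtPrime p) (hκ : κ.IsCyclotomic)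
    (L : Data ℚ (W.geomPrimaryTorsion p) p)
    (hC : ∀ (v : HeightOneSpectrum (𝓞 ℚ)) (hv : ((p : ℕ) : 𝓞 ℚ) ∈ v.asIdeal),
      (∀ c ∈ (L v hv).plus, ∃ c' ∈ (L v hv).plus, p • c' = c) ∧
        Nat.card ↥((L v hv).plus ⊓ (↥(W.geomPrimaryTorsion p))[(p : ℤ)]) = p)
    (hD : ∀ (v : HeightOneSpectrum (𝓞 ℚ)) (hv : ((p : ℕ) : 𝓞 ℚ) ∈ v.asIdeal),
      ∀ x ∈ inertia v, ∀ m : W.geomPrimaryTorsion p, x • m - m ∈ (L v hv).plus)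
    (S₀ : Finset (HeightOneSpectrum (𝓞 ℚ))) (hS₀ : ∀ v ∈ S₀, ((p : ℕ) : 𝓞 ℚ) ∉ v.asIdeal)
    [hfin : Finite ↥(datumSelmerInfty κ (W.geomPrimaryTorsion p) L
        (↑S₀ : Set (HeightOneSpectrum (𝓞 ℚ))) ⊓
      (subgroupH1 κ.kerSubgroup (W.geomPrimaryTorsion p))[(p : ℤ)])] :
    ∀ s ∈ datumSelmerInfty κ (W.geomPrimaryTorsion p) L (↑S₀ : Set (HeightOneSpectrum (𝓞 ℚ))),
      ∃ t ∈ datumSelmerInfty κ (W.geomPrimaryTorsion p) L (↑S₀ : Set (HeightOneSpectrum (𝓞 ℚ))),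
        p • t = s := by
  by_cases hsplit : W.HasSplitMultiplicativeReductionAtPrime p
  · exact datumSelmer_divisible_of_finite_torsionBy_of_split W p κ h415 h23 hInf hT hp2 hsplit hκ L hC
      hD S₀ hS₀
  · exact datumSelmer_divisible_of_finite_torsionBy_of_not_split W p κ h415 h23 hT' hp2 hmult hsplit
      hκ L hC hD S₀ hS₀

end Summit.BirchSwinnertonDyer.Rank1Residual.X2.DatumSelmerDivisibleDerived

end
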